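import Literature.Algebra.Homology.DiscreteRepLayerColimitGroupCohomology
import HarnessLib

/-!
# Maps out of `Extⁿ_{C_Γ}(k, M) = lim→_U Hⁿ(Γ⧸U, M^U)`: DESCENT of a compatible family of layer maps
# given on a cofinal family of open normal subgroups (Serre, *Galois Cohomology* I §2.2 Prop. 8)

Topic `Algebra/Homology`; namespace `Literature.Algebra.Homology.DiscreteRep.LayerColimit`.  One
`Prop`-valued structure (`IsCompatibleFamily`: the family of open normal subgroups is cofinal and the
layer maps are compatible with the inflation transitions `stepG`), one definition with body (`desc`,
the descended additive map `Extⁿ_{C_Γ}(k, M) →+ A`) and theorems; no named fact, no instance, no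
`sorry`.  Sequel of `DiscreteRepLayerColimitGroupCohomology` (door-c4 g15: (d) in `groupCohomology`
currency — `inflG`, `stepG`, `exists_inflG_eq`, `exists_stepG_eq_stepG`, `inflG_stepG`, `stepG_stepG`).

THE POINT.  The colimit theorem (d) says `Extⁿ_{C_Γ}(k, M)` (for `Γ` profinite, `M ∈ C_Γ`) is the
directed union of the images of the finite layers `Hⁿ(Γ⧸U, M^U)`, two layer classes having the same
image iff they agree after some inflation.  Consequently an additive map OUT of `Extⁿ_{C_Γ}(k, M)` is
the same thing as a family of additive maps out of the layers compatible with the inflations, and it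
suffices to give the family on any COFINAL set of layers (Serre: the colimit may be computed over any
cofinal family of open normal subgroups).  This file provides that universal property in the form the
arithmetic instantiations need: for `V : ι → OpenNormalSubgroup Γ` cofinal and additive maps
`f i : Hⁿ(Γ⧸V i, M^{V i}) →+ A` with `f j ∘ stepG (V i) (V j) = f i` (`V j ≤ V i`):

* `IsCompatibleFamily.eq_of_inflG_eq` — two layer classes with the same image in the limit have the
  same value (`inflG (V i) c = inflG (V j) c' → f i c = f j c'`);
* **`desc`**, **`desc_inflG : desc (inflG (V i) c) = f i c`**, `desc_inflG_of_le` (value on a class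
  inflated from an arbitrary layer `W ⊇ V i`), **`desc_unique`**;
* **`desc_injective`** (if every `f i` is injective), **`desc_surjective`** (if the `f i` are jointly
  surjective), `desc_bijective`, `mem_range_desc_iff`.

The intended instances: `Γ = Γ_F`, `M = C̄`, `n = 2`, `V E = Gal(F̄/E)` over the finite Galois layers
`E/F`, `f E = inv_{E/F}` (the invariant maps of the idèle class formation, compatible with inflation)
— giving THE invariant map `inv_F : H²(Γ_F, C̄) → ℚ/ℤ`, an isomorphism; and the same at an open
subgroup over the trace layers.  Written for Route A of the Poitou–Tate programme of crux
`stmt-BirchSwinnertonDyer-19295` (cell `bsd-schneider-ideate`, seat door-c4 gen 16): the hypothesis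
`invAt_bijective` of `DiscreteRepTateDuality.TateDualityHypotheses`.  HONEST FRAMING: homological
algebra only; no arithmetic statement and no case of BSD is proved here.

## References
* J.-P. Serre, *Galois Cohomology*, Springer (1997), I §2.2 Proposition 8 and the remark following it
  (`H^q(G, A) = lim→ H^q(G/U, A^U)`; any cofinal family of open normal subgroups). [SerreGaloisCohomology1997]
* D. Harari, *Galois Cohomology and Class Field Theory*, Universitext (2020), §4.3 Proposition 4.18,
  §16.1 Definition 16.3 (the invariant map of a class formation on `H²(Γ, C) = lim→ H²(Γ/U, C^U)`). [Harari2020]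
-/

noncomputable section

universe w v u

namespace Literature.Algebra.Homology

namespace DiscreteRep

namespace LayerColimit

open CategoryTheory CategoryTheory.Limits CategoryTheory.Abelian

variable {k Γ : Type u} [CommRing k] [Group Γ] [TopologicalSpace Γ] [IsTopologicalGroup Γ]
  [CompactSpace Γ] [TotallyDisconnectedSpace Γ]
  {ι : Type v} (V : ι → OpenNormalSubgroup Γ) (M : DiscreteRepCat k Γ) (n : ℕ)
  {A : Type w} [AddCommGroup A]
  (f : ∀ i, groupCohomology ((invariantsQuotFunctor k (V i : Subgroup Γ)).obj M) n →+ A)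

/-! ## §1 Compatible families on a cofinal set of layers -/

/-- **A compatible family of layer maps on a cofinal family of open normal subgroups**: every open
normal subgroup contains some `V i`, and the maps `f i : Hⁿ(Γ⧸V i, M^{V i}) →+ A` satisfy
`f j ∘ Inf = f i` for `V j ≤ V i`. [cite: SerreGaloisCohomology1997, I §2.2 Proposition 8] -/
structure IsCompatibleFamily : Prop where
  /-- The family is cofinal among the open normal subgroups. -/
  cofinal : ∀ W : OpenNormalSubgroup Γ, ∃ i, (V i : Subgroup Γ) ≤ W
  /-- The maps are compatible with the inflation transitions. -/
  compat : ∀ (i j : ι) (h : (V j : Subgroup Γ) ≤ V i)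
    (c : groupCohomology ((invariantsQuotFunctor k (V i : Subgroup Γ)).obj M) n),
    f j (stepG (V i) (V j) h M n c) = f i c

namespace IsCompatibleFamily

variable {V M n f} (hf : IsCompatibleFamily V M n f)
include hf

omit [IsTopologicalGroup Γ] [CompactSpace Γ] [TotallyDisconnectedSpace Γ] in
/-- A member of the family below two given open normal subgroups.
[cite: SerreGaloisCohomology1997, I §2.2 Proposition 8] -/
theorem exists_le_le (W W' : OpenNormalSubgroup Γ) :
    ∃ i, (V i : Subgroup Γ) ≤ W ∧ (V i : Subgroup Γ) ≤ W' := by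
  obtain ⟨i, hi⟩ := hf.cofinal (W ⊓ W')
  exact ⟨i, hi.trans (coe_le_coe_of_le inf_le_left), hi.trans (coe_le_coe_of_le inf_le_right)⟩

/-- **Every class of `Extⁿ_{C_Γ}(k, M)` is inflated from a layer of the family.**
[cite: SerreGaloisCohomology1997, I §2.2 Proposition 8] -/
theorem exists_inflG_eq (x : Ext (triv (Γ := Γ) k) M n) :
    ∃ (i : ι) (c : groupCohomology ((invariantsQuotFunctor k (V i : Subgroup Γ)).obj M) n),
      inflG (V i) M n c = x := by
  obtain ⟨W, c, rfl⟩ := LayerColimit.exists_inflG_eq n M x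
  obtain ⟨i, hi⟩ := hf.cofinal W
  exact ⟨i, stepG W (V i) hi M n c, inflG_stepG W (V i) hi M n c⟩

/-- **Two layer classes of the family with the same image in the limit have the same value** (they
agree after inflation to a common deeper member of the family, by (d) and cofinality).
[cite: SerreGaloisCohomology1997, I §2.2 Proposition 8] -/
theorem eq_of_inflG_eq {i j : ι}
    (c : groupCohomology ((invariantsQuotFunctor k (V i : Subgroup Γ)).obj M) n)
    (c' : groupCohomology ((invariantsQuotFunctor k (V j : Subgroup Γ)).obj M) n)
    (h : inflG (V i) M n c = inflG (V j) M n c') : f i c = f j c' := by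
  -- move both classes to the common layer `W = V i ⊓ V j`
  set W : OpenNormalSubgroup Γ := V i ⊓ V j with hW
  have hWi : (W : Subgroup Γ) ≤ V i := coe_le_coe_of_le inf_le_left
  have hWj : (W : Subgroup Γ) ≤ V j := coe_le_coe_of_le inf_le_right
  have hW' : inflG W M n (stepG (V i) W hWi M n c) = inflG W M n (stepG (V j) W hWj M n c') := by
    rw [inflG_stepG, inflG_stepG, h]
  obtain ⟨W'', hW'', heq⟩ := exists_stepG_eq_stepG n M W _ _ hW'
  obtain ⟨l, hl⟩ := hf.cofinal W''
  have e := congrArg (stepG W'' (V l) hl M n) heq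
  rw [stepG_stepG, stepG_stepG, stepG_stepG, stepG_stepG] at e
  rw [← hf.compat i l (hl.trans (hW''.trans hWi)) c, ← hf.compat j l (hl.trans (hW''.trans hWj)) c', e]

/-- The value of the family on a class inflated from an arbitrary open normal subgroup `W` does not
depend on the member `V i ≤ W` used to evaluate it. [cite: SerreGaloisCohomology1997, I §2.2 Proposition 8] -/
theorem eq_of_le_of_le (W : OpenNormalSubgroup Γ) {i j : ι} (hi : (V i : Subgroup Γ) ≤ W)
    (hj : (V j : Subgroup Γ) ≤ W) (c : groupCohomology ((invariantsQuotFunctor k (W : Subgroup Γ)).obj M) n) :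
    f i (stepG W (V i) hi M n c) = f j (stepG W (V j) hj M n c) :=
  hf.eq_of_inflG_eq _ _ (by rw [inflG_stepG, inflG_stepG])

end IsCompatibleFamily

/-! ## §2 The descended map -/

/-- A representative of a class in a layer of the family, packaged as a dependent pair (auxiliary).
[cite: SerreGaloisCohomology1997, I §2.2 Proposition 8] -/
theorem exists_sigma_inflG_eq (hf : IsCompatibleFamily V M n f) (x : Ext (triv (Γ := Γ) k) M n) :
    ∃ (p : Σ i, groupCohomology ((invariantsQuotFunctor k (V i : Subgroup Γ)).obj M) n),
      inflG (V p.1) M n p.2 = x := by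
  obtain ⟨i, c, h⟩ := hf.exists_inflG_eq x
  exact ⟨⟨i, c⟩, h⟩

/-- The descended map as a bare function: `x ↦ f i c` for a CHOSEN `(i, c)` with `Inf c = x`.
[cite: SerreGaloisCohomology1997, I §2.2 Proposition 8] -/
def descFun (hf : IsCompatibleFamily V M n f) (x : Ext (triv (Γ := Γ) k) M n) : A :=
  f (exists_sigma_inflG_eq V M n f hf x).choose.1 (exists_sigma_inflG_eq V M n f hf x).choose.2

/-- **The chosen representative is irrelevant**: `descFun x = f i c` for ANY `(i, c)` with `Inf c = x`.
[cite: SerreGaloisCohomology1997, I §2.2 Proposition 8] -/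
theorem descFun_eq (hf : IsCompatibleFamily V M n f) {i : ι}
    (c : groupCohomology ((invariantsQuotFunctor k (V i : Subgroup Γ)).obj M) n)
    {x : Ext (triv (Γ := Γ) k) M n} (h : inflG (V i) M n c = x) : descFun V M n f hf x = f i c :=
  hf.eq_of_inflG_eq _ _ ((exists_sigma_inflG_eq V M n f hf x).choose_spec.trans h.symm)

/-- **The descended map `Extⁿ_{C_Γ}(k, M) →+ A`** of a compatible family on a cofinal set of layers:
`x ↦ f i c` for any `(i, c)` with `Inf c = x` (well defined by `IsCompatibleFamily.eq_of_inflG_eq`;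
additive because two classes are inflated from a common member of the family).
[cite: SerreGaloisCohomology1997, I §2.2 Proposition 8][cite: Harari2020, §16.1 Definition 16.3] -/
def desc (hf : IsCompatibleFamily V M n f) : Ext (triv (Γ := Γ) k) M n →+ A where
  toFun := descFun V M n f hf
  map_zero' := by
    obtain ⟨i, -⟩ := hf.cofinal (topOpenNormalSubgroup Γ)
    rw [descFun_eq V M n f hf (i := i) 0 (map_zero _), map_zero]
  map_add' x y := by
    obtain ⟨i, c, rfl⟩ := hf.exists_inflG_eq x
    obtain ⟨j, c', rfl⟩ := hf.exists_inflG_eq y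
    obtain ⟨l, hli, hlj⟩ := hf.exists_le_le (V i) (V j)
    rw [descFun_eq V M n f hf c rfl, descFun_eq V M n f hf c' rfl,
      ← inflG_stepG (V i) (V l) hli M n c, ← inflG_stepG (V j) (V l) hlj M n c', ← map_add,
      descFun_eq V M n f hf _ rfl, map_add, hf.compat, hf.compat]

variable {V M n f}

/-- `desc` is `descFun`. [cite: SerreGaloisCohomology1997, I §2.2 Proposition 8] -/
theorem desc_apply (hf : IsCompatibleFamily V M n f) (x : Ext (triv (Γ := Γ) k) M n) :
    desc V M n f hf x = descFun V M n f hf x := rfl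

/-- **`desc (Inf c) = f i c`** for every member of the family.
[cite: SerreGaloisCohomology1997, I §2.2 Proposition 8][cite: Harari2020, §16.1 Definition 16.3] -/
theorem desc_inflG (hf : IsCompatibleFamily V M n f) (i : ι)
    (c : groupCohomology ((invariantsQuotFunctor k (V i : Subgroup Γ)).obj M) n) :
    desc V M n f hf (inflG (V i) M n c) = f i c :=
  descFun_eq V M n f hf c rfl

/-- **`desc` on a class inflated from an arbitrary layer `W`**: `desc (Inf_W c) = f i (Inf_{W → V i} c)`
for any member `V i ≤ W`. [cite: SerreGaloisCohomology1997, I §2.2 Proposition 8] -/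
theorem desc_inflG_of_le (hf : IsCompatibleFamily V M n f) (W : OpenNormalSubgroup Γ) {i : ι}
    (hi : (V i : Subgroup Γ) ≤ W) (c : groupCohomology ((invariantsQuotFunctor k (W : Subgroup Γ)).obj M) n) :
    desc V M n f hf (inflG W M n c) = f i (stepG W (V i) hi M n c) := by
  rw [← inflG_stepG W (V i) hi M n c, desc_inflG]

/-- **Uniqueness**: an additive map out of `Extⁿ_{C_Γ}(k, M)` is determined by its values on the
layers of a cofinal family. [cite: SerreGaloisCohomology1997, I §2.2 Proposition 8] -/
theorem eq_desc_of_forall_inflG (hf : IsCompatibleFamily V M n f) (g : Ext (triv (Γ := Γ) k) M n →+ A)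
    (hg : ∀ (i : ι) (c : groupCohomology ((invariantsQuotFunctor k (V i : Subgroup Γ)).obj M) n),
      g (inflG (V i) M n c) = f i c) :
    g = desc V M n f hf := by
  refine AddMonoidHom.ext fun x => ?_
  obtain ⟨i, c, rfl⟩ := hf.exists_inflG_eq x
  rw [hg i c, desc_inflG hf i c]

/-- Two additive maps out of `Extⁿ_{C_Γ}(k, M)` agreeing on the layers of a cofinal family are equal.
[cite: SerreGaloisCohomology1997, I §2.2 Proposition 8] -/
theorem addMonoidHom_ext_of_cofinal {B : Type w} [AddCommGroup B]
    (hV : ∀ W : OpenNormalSubgroup Γ, ∃ i, (V i : Subgroup Γ) ≤ W) (g g' : Ext (triv (Γ := Γ) k) M n →+ B)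
    (h : ∀ (i : ι) (c : groupCohomology ((invariantsQuotFunctor k (V i : Subgroup Γ)).obj M) n),
      g (inflG (V i) M n c) = g' (inflG (V i) M n c)) :
    g = g' := by
  refine AddMonoidHom.ext fun x => ?_
  obtain ⟨W, c, rfl⟩ := LayerColimit.exists_inflG_eq n M x
  obtain ⟨i, hi⟩ := hV W
  rw [← inflG_stepG W (V i) hi M n c, h]

/-! ## §3 Injectivity, surjectivity -/

/-- **`desc` is injective when every `f i` is.** [cite: Harari2020, §16.1 Definition 16.3] -/
theorem desc_injective (hf : IsCompatibleFamily V M n f) (hinj : ∀ i, Function.Injective (f i)) :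
    Function.Injective (desc V M n f hf) := by
  refine (injective_iff_map_eq_zero _).2 fun x hx => ?_
  obtain ⟨i, c, rfl⟩ := hf.exists_inflG_eq x
  rw [desc_inflG] at hx
  rw [(injective_iff_map_eq_zero (f i)).1 (hinj i) c hx, map_zero]

/-- A value of some `f i` is a value of `desc`. [cite: Harari2020, §16.1 Definition 16.3] -/
theorem mem_range_desc (hf : IsCompatibleFamily V M n f) {a : A} (i : ι)
    (c : groupCohomology ((invariantsQuotFunctor k (V i : Subgroup Γ)).obj M) n) (hc : f i c = a) :
    a ∈ Set.range (desc V M n f hf) :=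
  ⟨inflG (V i) M n c, (desc_inflG hf i c).trans hc⟩

/-- **The image of `desc` is the union of the images of the `f i`.** [cite: Harari2020, §16.1 Definition 16.3] -/
theorem mem_range_desc_iff (hf : IsCompatibleFamily V M n f) (a : A) :
    a ∈ Set.range (desc V M n f hf) ↔ ∃ (i : ι)
      (c : groupCohomology ((invariantsQuotFunctor k (V i : Subgroup Γ)).obj M) n), f i c = a := by
  constructor
  · rintro ⟨x, rfl⟩
    obtain ⟨i, c, rfl⟩ := hf.exists_inflG_eq x
    exact ⟨i, c, (desc_inflG hf i c).symm⟩
  · rintro ⟨i, c, hc⟩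
    exact mem_range_desc hf i c hc

/-- **`desc` is surjective when the `f i` are jointly surjective.** [cite: Harari2020, §16.1 Definition 16.3] -/
theorem desc_surjective (hf : IsCompatibleFamily V M n f)
    (hsurj : ∀ a : A, ∃ (i : ι) (c : groupCohomology ((invariantsQuotFunctor k (V i : Subgroup Γ)).obj M) n),
      f i c = a) :
    Function.Surjective (desc V M n f hf) := fun a =>
  (mem_range_desc_iff hf a).2 (hsurj a)

/-- **`desc` is bijective when every `f i` is injective and the family is jointly surjective** — the
shape in which the invariant map of a class formation `H²(Γ, C) = lim→ H²(Γ⧸U, C^U) ⥲ ℚ/ℤ` arises from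
the layer isomorphisms `H²(Γ⧸U, C^U) ⥲ (1/[Γ:U])ℤ/ℤ`. [cite: Harari2020, §16.1 Definition 16.3] -/
theorem desc_bijective (hf : IsCompatibleFamily V M n f) (hinj : ∀ i, Function.Injective (f i))
    (hsurj : ∀ a : A, ∃ (i : ι) (c : groupCohomology ((invariantsQuotFunctor k (V i : Subgroup Γ)).obj M) n),
      f i c = a) :
    Function.Bijective (desc V M n f hf) :=
  ⟨desc_injective hf hinj, desc_surjective hf hsurj⟩

/-- `desc x = 0` iff some (equivalently every) representative layer class of the family has value `0`,
when the `f i` are injective: `desc (Inf c) = 0 ↔ c = 0`. [cite: Harari2020, §16.1 Definition 16.3] -/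
theorem desc_inflG_eq_zero_iff (hf : IsCompatibleFamily V M n f) (hinj : ∀ i, Function.Injective (f i))
    (i : ι) (c : groupCohomology ((invariantsQuotFunctor k (V i : Subgroup Γ)).obj M) n) :
    desc V M n f hf (inflG (V i) M n c) = 0 ↔ c = 0 := by
  rw [desc_inflG]
  exact ⟨fun h => (injective_iff_map_eq_zero (f i)).1 (hinj i) c h, fun h => by rw [h, map_zero]⟩

/-! ## §4 Post-composition and scalar compatibilities -/

omit [IsTopologicalGroup Γ] [CompactSpace Γ] [TotallyDisconnectedSpace Γ] in
/-- A family post-composed with an additive map is compatible. [cite: SerreGaloisCohomology1997, I §2.2 Proposition 8] -/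
theorem IsCompatibleFamily.comp {B : Type w} [AddCommGroup B] (hf : IsCompatibleFamily V M n f) (φ : A →+ B) :
    IsCompatibleFamily V M n (fun i => φ.comp (f i)) :=
  ⟨hf.cofinal, fun i j h c => by rw [AddMonoidHom.comp_apply, AddMonoidHom.comp_apply, hf.compat]⟩

/-- **Functoriality in the target**: for `φ : A →+ B`, `φ ∘ desc f = desc (φ ∘ f)`.
[cite: SerreGaloisCohomology1997, I §2.2 Proposition 8] -/
theorem comp_desc {B : Type w} [AddCommGroup B] (hf : IsCompatibleFamily V M n f) (φ : A →+ B) :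
    φ.comp (desc V M n f hf) = desc V M n (fun i => φ.comp (f i)) (hf.comp φ) :=
  eq_desc_of_forall_inflG (hf.comp φ) _ fun i c => by
    rw [AddMonoidHom.comp_apply, desc_inflG hf i c, AddMonoidHom.comp_apply]

omit [IsTopologicalGroup Γ] [CompactSpace Γ] [TotallyDisconnectedSpace Γ] in
/-- A family rescaled by a natural number is compatible. [cite: SerreGaloisCohomology1997, I §2.2 Proposition 8] -/
theorem IsCompatibleFamily.nsmul (hf : IsCompatibleFamily V M n f) (m : ℕ) :
    IsCompatibleFamily V M n (fun i => m • f i) :=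
  ⟨hf.cofinal, fun i j h c => by rw [AddMonoidHom.nsmul_apply, AddMonoidHom.nsmul_apply, hf.compat]⟩

/-- `desc (m • f) = m • desc f`. [cite: SerreGaloisCohomology1997, I §2.2 Proposition 8] -/
theorem desc_nsmul (hf : IsCompatibleFamily V M n f) (m : ℕ) :
    desc V M n (fun i => m • f i) (hf.nsmul m) = m • desc V M n f hf :=
  (eq_desc_of_forall_inflG (hf.nsmul m) _ fun i c => by
    rw [AddMonoidHom.nsmul_apply, desc_inflG hf i c, AddMonoidHom.nsmul_apply]).symm

end LayerColimit

end DiscreteRep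

end Literature.Algebra.Homology

end
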